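import Literature.MathematicalPhysics.QuantumLattice.LiebSpinReflection
import Mathlib.Analysis.Matrix.Order
import HarnessLib

/-!
# Spin-reflection positivity for one rectangular block of a graded Lieb operator

Support file for the certified many-body solver (venture `CertifiedManyBodySolver`, lane A rows):
first certified bounds; not a superconductivity verdict; every number certified or labelled float.

Lieb's two-species coordinates write a vector of the two-species Fock space over a finite set `Λ` as
a coefficient matrix `M : Matrix (Finset Λ) (Finset Λ) ℂ`, and a particle–hole symmetric repulsive
Hamiltonian acts as `M ↦ 𝓛 M = K M + M K - U Σₓ Lₓ M Lₓ` (`liebOp K L (-U)`, `U ≥ 0`) with `K`, `Lₓ`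
Hermitian and *graded*: they preserve the particle number `α.card` of the spinless configurations
`α : Finset Λ`. A vector of the `S^z` sector `(N↑, N↓) = (a, |Λ| - b)` is a matrix supported on the
rectangular block `a`-particle rows × `b`-particle columns.

**Theorem** (`re_hsInner_liebOp_ge_of_block`, Lieb 1989 / Tian 1998, abstract form): if the
quadratic form `Re ⟨Z, 𝓛 Z⟩ ≥ q ‖Z‖²` holds on the two *square* blocks `(a, a)` and `(b, b)`, then
it holds on the rectangular block `(a, b)`. Proof (Tian, PRB 58 (1998) 7612, Step 3, with the
Hermitian dilation `X = M + Mᴴ` in place of the zero-padded polar factorisation): `E(X) = 2 E(M)` by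
the grading, `E(|X|) ≤ E(X)` by Lieb's spin-reflection positivity (`re_trace_unitConj_mul_le`), and
`|X| = Π_a |X| Π_a + Π_b |X| Π_b` with both blocks of Hilbert–Schmidt norm `‖M‖`, so that `2 q ‖M‖²
≤ E(Π_a |X| Π_a) + E(Π_b |X| Π_b) = E(|X|) ≤ 2 E(M)`.

For the Hubbard / Anderson-cluster rows this reduces an all-sector positivity certificate
`h - q·1 ⪰ 0` to the half-filled sectors `N = |Λ|` (file `AndersonHalfFilledBlock`). The lemmas
below generalise the (private) graded-projection lemmas of
`Literature/MathematicalPhysics/QuantumLattice/HubbardChargeGapSpinGap.lean` from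
`liebOp (hoppingMatrix G t) numberAt (-U)` to an arbitrary graded pair `(K, L)`.

References: E. H. Lieb, *Two theorems on the Hubbard model*, Phys. Rev. Lett. **62** (1989) 1201,
proof of Theorem 1; G.-S. Tian, Phys. Rev. B **58** (1998) 7612, Step 3.
-/

namespace Summit.Ventures.CertifiedManyBodySolver.Rows

open Matrix Finset Literature.MathematicalPhysics.QuantumLattice
open scoped ComplexOrder

section Graded

variable {Λ : Type*} [DecidableEq Λ] [Fintype Λ] {X : Type*} [Fintype X]

/-! ### The particle-number projections `Π_a = diagonal [α.card = a]` -/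

/-- `Π_a` acts on the left by restricting the rows to particle number `a`. [folklore] -/
theorem cardProj_mul_apply (a : ℕ) (M : Matrix (Finset Λ) (Finset Λ) ℂ) (α β : Finset Λ) :
    ((diagonal fun γ : Finset Λ => if γ.card = a then (1 : ℂ) else 0) * M) α β =
      if α.card = a then M α β else 0 := by
  rw [diagonal_mul]
  split_ifs <;> simp

/-- `Π_a` acts on the right by restricting the columns to particle number `a`. [folklore] -/
theorem mul_cardProj_apply (a : ℕ) (M : Matrix (Finset Λ) (Finset Λ) ℂ) (α β : Finset Λ) :
    (M * (diagonal fun γ : Finset Λ => if γ.card = a then (1 : ℂ) else 0)) α β =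
      if β.card = a then M α β else 0 := by
  rw [mul_diagonal]
  split_ifs <;> simp

omit [Fintype Λ] in
/-- `Π_a` is Hermitian. [folklore] -/
theorem cardProj_conjTranspose (a : ℕ) :
    (diagonal fun α : Finset Λ => if α.card = a then (1 : ℂ) else 0)ᴴ =
      (diagonal fun α : Finset Λ => if α.card = a then (1 : ℂ) else 0) := by
  rw [diagonal_conjTranspose]
  congr 1
  funext α
  simp only [Pi.star_apply]
  split_ifs <;> simp

/-- `Π_a` is idempotent. [folklore] -/
theorem cardProj_mul_cardProj (a : ℕ) :
    (diagonal fun α : Finset Λ => if α.card = a then (1 : ℂ) else 0) *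
        (diagonal fun α : Finset Λ => if α.card = a then (1 : ℂ) else 0) =
      (diagonal fun α : Finset Λ => if α.card = a then (1 : ℂ) else 0) := by
  rw [diagonal_mul_diagonal]
  congr 1
  funext α
  split_ifs <;> simp

/-- A matrix with `a`-particle rows is fixed by `Π_a` on the left. [folklore] -/
theorem cardProj_mul_of_row {a : ℕ} {M : Matrix (Finset Λ) (Finset Λ) ℂ}
    (hM : ∀ α β, M α β ≠ 0 → α.card = a) :
    (diagonal fun α : Finset Λ => if α.card = a then (1 : ℂ) else 0) * M = M := by
  ext α β
  rw [cardProj_mul_apply]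
  by_cases h0 : M α β = 0
  · rw [h0]; split_ifs <;> rfl
  · rw [if_pos (hM α β h0)]

/-- A matrix with `a`-particle rows is killed by `Π_c`, `c ≠ a`, on the left. [folklore] -/
theorem cardProj_mul_eq_zero_of_row {a c : ℕ} (hca : c ≠ a)
    {M : Matrix (Finset Λ) (Finset Λ) ℂ} (hM : ∀ α β, M α β ≠ 0 → α.card = a) :
    (diagonal fun α : Finset Λ => if α.card = c then (1 : ℂ) else 0) * M = 0 := by
  ext α β
  rw [cardProj_mul_apply, Matrix.zero_apply]
  by_cases h0 : M α β = 0
  · rw [h0]; split_ifs <;> rfl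
  · rw [if_neg]
    exact fun h => hca (h.symm.trans (hM α β h0))

/-- A matrix with `b`-particle columns is fixed by `Π_b` on the right. [folklore] -/
theorem mul_cardProj_of_col {b : ℕ} {M : Matrix (Finset Λ) (Finset Λ) ℂ}
    (hM : ∀ α β, M α β ≠ 0 → β.card = b) :
    M * (diagonal fun α : Finset Λ => if α.card = b then (1 : ℂ) else 0) = M := by
  ext α β
  rw [mul_cardProj_apply]
  by_cases h0 : M α β = 0
  · rw [h0]; split_ifs <;> rfl
  · rw [if_pos (hM α β h0)]

/-- A matrix with `b`-particle columns is killed by `Π_c`, `c ≠ b`, on the right. [folklore] -/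
theorem mul_cardProj_eq_zero_of_col {b c : ℕ} (hcb : c ≠ b)
    {M : Matrix (Finset Λ) (Finset Λ) ℂ} (hM : ∀ α β, M α β ≠ 0 → β.card = b) :
    M * (diagonal fun α : Finset Λ => if α.card = c then (1 : ℂ) else 0) = 0 := by
  ext α β
  rw [mul_cardProj_apply, Matrix.zero_apply]
  by_cases h0 : M α β = 0
  · rw [h0]; split_ifs <;> rfl
  · rw [if_neg]
    exact fun h => hcb (h.symm.trans (hM α β h0))

omit [DecidableEq Λ] [Fintype Λ] in
/-- The adjoint of a matrix supported on the block `(a, b)` is supported on `(b, a)`. [folklore] -/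
theorem supp_conjTranspose {a b : ℕ} {M : Matrix (Finset Λ) (Finset Λ) ℂ}
    (hM : ∀ α β, M α β ≠ 0 → α.card = a ∧ β.card = b) :
    ∀ α β, Mᴴ α β ≠ 0 → α.card = b ∧ β.card = a := by
  intro α β h
  rw [conjTranspose_apply, star_ne_zero] at h
  exact (hM β α h).symm

/-- `Π_c Z Π_d` is supported on the block `(c, d)`. [folklore] -/
theorem supp_cardProj_mul_mul_cardProj (c d : ℕ) (Z : Matrix (Finset Λ) (Finset Λ) ℂ) :
    ∀ α β : Finset Λ,
      ((diagonal fun γ : Finset Λ => if γ.card = c then (1 : ℂ) else 0) * Z *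
          (diagonal fun γ : Finset Λ => if γ.card = d then (1 : ℂ) else 0) :
          Matrix (Finset Λ) (Finset Λ) ℂ) α β ≠ 0 →
        α.card = c ∧ β.card = d := by
  intro α β h
  rw [mul_cardProj_apply] at h
  by_cases hβ : β.card = d
  · rw [if_pos hβ, cardProj_mul_apply] at h
    by_cases hα : α.card = c
    · exact ⟨hα, hβ⟩
    · rw [if_neg hα] at h
      exact absurd rfl h
  · rw [if_neg hβ] at h
    exact absurd rfl h

omit [DecidableEq Λ] in
/-- Matrices with rows of different particle numbers are Hilbert–Schmidt orthogonal. [folklore] -/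
theorem hsInner_eq_zero_of_row {a₁ a₂ : ℕ} (h : a₁ ≠ a₂)
    {M₁ M₂ : Matrix (Finset Λ) (Finset Λ) ℂ}
    (h₁ : ∀ α β, M₁ α β ≠ 0 → α.card = a₁) (h₂ : ∀ α β, M₂ α β ≠ 0 → α.card = a₂) :
    hsInner M₁ M₂ = 0 := by
  rw [hsInner_apply]
  refine Finset.sum_eq_zero fun α _ => Finset.sum_eq_zero fun β _ => ?_
  by_cases hα : M₁ α β = 0
  · rw [hα, star_zero, zero_mul]
  · have h2 : M₂ α β = 0 := by
      by_contra h2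
      exact h ((h₁ α β hα).symm.trans (h₂ α β h2))
    rw [h2, mul_zero]

/-! ### Graded Lieb operators -/

omit [DecidableEq Λ] in
/-- A graded Lieb operator `𝓛 M = K M + M K + U Σₓ Lₓ M Lₓ` (`K`, `Lₓ` preserve the particle number
of configurations) preserves the particle number of the rows of `M`. [folklore] -/
theorem row_liebOp {K : Matrix (Finset Λ) (Finset Λ) ℂ} {L : X → Matrix (Finset Λ) (Finset Λ) ℂ}
    (hKg : ∀ α γ, K α γ ≠ 0 → α.card = γ.card) (hLg : ∀ x α γ, L x α γ ≠ 0 → α.card = γ.card)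
    (U : ℝ) {c : ℕ} {M : Matrix (Finset Λ) (Finset Λ) ℂ} (hM : ∀ α β, M α β ≠ 0 → α.card = c) :
    ∀ α β, liebOp K L U M α β ≠ 0 → α.card = c := by
  intro α β h
  by_contra hc
  apply h
  have hrow : ∀ γ, M α γ = 0 := fun γ => by_contra fun h' => hc (hM α γ h')
  have h1 : (K * M) α β = 0 := by
    rw [Matrix.mul_apply]
    refine Finset.sum_eq_zero fun γ _ => ?_
    by_cases hK : K α γ = 0
    · rw [hK, zero_mul]
    · have hγ : M γ β = 0 := by
        by_contra h'
        exact hc ((hKg α γ hK).trans (hM γ β h'))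
      rw [hγ, mul_zero]
  have h2 : (M * K) α β = 0 := by
    rw [Matrix.mul_apply]
    exact Finset.sum_eq_zero fun γ _ => by rw [hrow γ, zero_mul]
  have h3 : ∀ x : X, (L x * M * L x) α β = 0 := by
    intro x
    rw [Matrix.mul_apply]
    refine Finset.sum_eq_zero fun δ _ => ?_
    rw [Matrix.mul_apply]
    have : ∑ γ, L x α γ * M γ δ = 0 := by
      refine Finset.sum_eq_zero fun γ _ => ?_
      by_cases hL : L x α γ = 0
      · rw [hL, zero_mul]
      · have hγ : M γ δ = 0 := by
          by_contra h'
          exact hc ((hLg x α γ hL).trans (hM γ δ h'))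
        rw [hγ, mul_zero]
    rw [this, zero_mul]
  rw [liebOp, Matrix.add_apply, Matrix.add_apply, Matrix.smul_apply, Matrix.sum_apply, h1, h2,
    Finset.sum_eq_zero fun x _ => h3 x, smul_zero, add_zero, add_zero]

omit [DecidableEq Λ] in
/-- `E(Mᴴ) = E(M)` for the functional `E(M) = ⟨M, 𝓛 M⟩` of a Lieb operator with Hermitian `K`,
`Lₓ` (`(𝓛 M)ᴴ = 𝓛 Mᴴ` and `𝓛` is Hilbert–Schmidt self-adjoint). Lieb, PRL 62 (1989) 1201, proof of
Theorem 1. [cite: LiebPRL1989, proof of Theorem 1] -/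
theorem hsInner_liebOp_conjTranspose_self {K : Matrix (Finset Λ) (Finset Λ) ℂ}
    {L : X → Matrix (Finset Λ) (Finset Λ) ℂ} (hK : Kᴴ = K) (hL : ∀ x, (L x)ᴴ = L x) (U : ℝ)
    (M : Matrix (Finset Λ) (Finset Λ) ℂ) :
    hsInner Mᴴ (liebOp K L U Mᴴ) = hsInner M (liebOp K L U M) := by
  calc hsInner Mᴴ (liebOp K L U Mᴴ)
      = hsInner Mᴴ (liebOp K L U M)ᴴ := by rw [liebOp_conjTranspose U hK hL]
    _ = hsInner (liebOp K L U M) M := by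
        simp only [hsInner, conjTranspose_conjTranspose]
        rw [trace_mul_comm]
    _ = hsInner M (liebOp K L U M) := (hsInner_liebOp_comm U hK hL M M).symm

/-- **Spin-reflection positivity for the dilation** (Lieb's `|W|`): for Hermitian `X`, Hermitian
`Lₓ` and `U ≥ 0` there is a positive semidefinite `P` (`= |X|`) with `P² = X²` and `E(P) ≤ E(X)`
for the attractive functional `E(Z) = ⟨Z, 𝓛 Z⟩ = 2 Tr K Z² - U Σₓ Tr Z Lₓ Z Lₓ`.
Lieb, PRL 62 (1989) 1201, proof of Theorem 1 (the inequality after eq. (4)).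
[cite: LiebPRL1989, proof of Theorem 1] -/
theorem exists_abs_energy_le {K : Matrix (Finset Λ) (Finset Λ) ℂ}
    {L : X → Matrix (Finset Λ) (Finset Λ) ℂ} (hL : ∀ x, (L x)ᴴ = L x) {U : ℝ} (hU : 0 ≤ U)
    {X' : Matrix (Finset Λ) (Finset Λ) ℂ} (hX : X'.IsHermitian) :
    ∃ P : Matrix (Finset Λ) (Finset Λ) ℂ, P.PosSemidef ∧ P * P = X' * X' ∧
      (hsInner P (liebOp K L (-U) P)).re ≤ (hsInner X' (liebOp K L (-U) X')).re := by
  classical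
  set V : Matrix (Finset Λ) (Finset Λ) ℂ :=
    (hX.eigenvectorUnitary : Matrix (Finset Λ) (Finset Λ) ℂ) with hVdef
  set f : Finset Λ → ℝ := hX.eigenvalues with hf
  have hV : Vᴴ * V = 1 := by
    rw [← star_eq_conjTranspose]
    exact Unitary.coe_star_mul_self hX.eigenvectorUnitary
  have hXeq : X' = unitConj V f := by
    conv_lhs => rw [hX.spectral_theorem]
    rw [Unitary.conjStarAlgAut_apply, star_eq_conjTranspose]
    rfl
  refine ⟨unitConj V |f|, posSemidef_unitConj V fun a => abs_nonneg _, ?_, ?_⟩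
  · rw [hXeq]
    exact unitConj_abs_mul_self V (hV := hV) f
  · rw [hXeq, hsInner_liebOp_of_conjTranspose_eq (unitConj_conjTranspose V |f|),
      hsInner_liebOp_of_conjTranspose_eq (unitConj_conjTranspose V f),
      unitConj_abs_mul_self V (hV := hV) f]
    simp only [Complex.add_re, Complex.re_ofReal_mul, Complex.re_sum, add_le_add_iff_left,
      Complex.ofReal_neg, neg_mul, Complex.neg_re]
    rw [neg_le_neg_iff]
    refine mul_le_mul_of_nonneg_left (Finset.sum_le_sum fun x _ => ?_) hU
    exact re_trace_unitConj_mul_le V f (hL x)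

open scoped MatrixOrder in
/-- Uniqueness of the positive semidefinite square root (Mathlib's `CFC.sqrt_unique`). [folklore] -/
theorem posSemidef_eq_of_mul_self_eq {B C : Matrix (Finset Λ) (Finset Λ) ℂ}
    (hB : B.PosSemidef) (hC : C.PosSemidef) (h : B * B = C * C) : B = C := by
  have h1 : CFC.sqrt (C * C) = B := CFC.sqrt_unique h hB.nonneg
  have h2 : CFC.sqrt (C * C) = C := CFC.sqrt_unique rfl hC.nonneg
  exact h1.symm.trans h2

/-- If `X` is off-diagonal for the splitting `ran Q ⊕ ker Q` of an orthogonal projection `Q`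
(`Q X + X Q = X`, `Q X Q = 0`), then the positive square root `P` of `X²` commutes with `Q`:
`Γ = 1 - 2Q` is a Hermitian involution with `Γ X Γ = -X`, so `Γ P Γ ≥ 0` squares to `X²` as well
and equals `P`. [folklore] -/
theorem proj_comm_of_sq_eq {Q X' P : Matrix (Finset Λ) (Finset Λ) ℂ} (hQh : Qᴴ = Q)
    (hQQ : Q * Q = Q) (h1 : Q * X' + X' * Q = X') (h2 : Q * X' * Q = 0)
    (hP : P.PosSemidef) (hPX : P * P = X' * X') : Q * P = P * Q := by
  set Γ : Matrix (Finset Λ) (Finset Λ) ℂ := 1 - (2 : ℂ) • Q with hΓ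
  have hΓΓ : Γ * Γ = 1 := by
    have : Γ * Γ = 1 - (4 : ℂ) • Q + (4 : ℂ) • (Q * Q) := by
      simp only [hΓ, sub_mul, mul_sub, one_mul, mul_one, Matrix.smul_mul, Matrix.mul_smul]
      module
    rw [this, hQQ]
    module
  have hΓh : Γᴴ = Γ := by
    rw [hΓ, conjTranspose_sub, conjTranspose_one, conjTranspose_smul, hQh]
    norm_num
  have hΓX : Γ * X' * Γ = -X' := by
    have : Γ * X' * Γ = X' - (2 : ℂ) • (Q * X' + X' * Q) + (4 : ℂ) • (Q * X' * Q) := by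
      simp only [hΓ, sub_mul, mul_sub, one_mul, mul_one, Matrix.smul_mul, Matrix.mul_smul,
        smul_add]
      module
    rw [this, h1, h2, smul_zero, add_zero]
    module
  have hXX : Γ * (X' * X') * Γ = X' * X' := by
    calc Γ * (X' * X') * Γ = (Γ * X' * Γ) * (Γ * X' * Γ) := by
          simp only [Matrix.mul_assoc]
          rw [← Matrix.mul_assoc Γ Γ, hΓΓ, Matrix.one_mul]
      _ = X' * X' := by rw [hΓX, neg_mul_neg]
  have hQpsd : (Γ * P * Γ).PosSemidef := by
    have h := hP.mul_mul_conjTranspose_same Γ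
    rwa [hΓh] at h
  have hQQ' : Γ * P * Γ * (Γ * P * Γ) = P * P := by
    calc Γ * P * Γ * (Γ * P * Γ) = Γ * (P * P) * Γ := by
          simp only [Matrix.mul_assoc]
          rw [← Matrix.mul_assoc Γ Γ, hΓΓ, Matrix.one_mul]
      _ = P * P := by rw [hPX, hXX]
  have hQ : Γ * P * Γ = P := posSemidef_eq_of_mul_self_eq hQpsd hP hQQ'
  have hΓP : Γ * P = P * Γ := by
    calc Γ * P = Γ * P * (Γ * Γ) := by rw [hΓΓ, Matrix.mul_one]
      _ = Γ * P * Γ * Γ := by simp only [Matrix.mul_assoc]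
      _ = P * Γ := by rw [hQ]
  have h3 : P - (2 : ℂ) • (Q * P) = P - (2 : ℂ) • (P * Q) := by
    have h := hΓP
    simp only [hΓ, sub_mul, mul_sub, one_mul, mul_one, Matrix.smul_mul, Matrix.mul_smul] at h
    exact h
  have h4 : (2 : ℂ) • (Q * P) = (2 : ℂ) • (P * Q) := sub_right_injective h3
  exact smul_right_injective _ two_ne_zero h4

end Graded

end Summit.Ventures.CertifiedManyBodySolver.Rows
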